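import Literature.Probability.RandomPlanarGeometry.DiscApproximation
import Literature.Probability.RandomPlanarGeometry.LSW2004USTProofs
import Literature.Probability.RandomPlanarGeometry.LSW2004USTPeanoExistence
import Literature.Probability.RandomPlanarGeometry.SLETraceContinuity
import Literature.Probability.RandomPlanarGeometry.RohdeSchrammCor35Proofs
import HarnessLib

/-!
# `HasSLETrace κ` for every `κ` from the three remaining printed estimates

Topic `Probability/RandomPlanarGeometry`; theorems only (no new named fact). The predicate
`Literature.Probability.RandomPlanarGeometry.HasSLETrace κ` ("chordal SLE_κ is a.s. generated by
a curve", `SLE.lean`) is, for all `κ` at once, the conjunction of the two named facts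
`hasSLETrace_of_ne_eight` (Rohde–Schramm, Ann. Math. 161 (2005), Thm. 5.1) and
`hasSLETrace_eight` (Lawler–Schramm–Werner, Ann. Probab. 32 (2004), Thm. 4.7) — `hasSLETrace`.
Both have meanwhile been reduced inside the tree to printed *estimates*:

* `κ ≠ 8`: `hasSLETrace_of_ne_eight_of_cor35` — everything in Rohde–Schramm's proof of Thm. 5.1
  except the one-point derivative estimate **Cor. 3.5** (`RohdeSchramm2005_cor35`, on the
  canonical space) is proved (Thm. 3.6 from Cor. 3.5, Thm. 4.1, `κ = 0`);
* `κ = 8`: `USTPeano.hasSLETrace_eight_of_LSW_facts` — [LSW04] Thm. 4.7 from the inputs of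
  `LSW2004UST.lean`, of which the two deterministic ones are now PROVED:
  `USTPeano.nonempty_peanoPath_holds` (§4.1, Peano paths exist) and
  `USTPeano.exists_capacityImage_holds` (§2.1, capacity parametrisation), leaving **Prop. 4.5**
  (uniform continuity of the UST Peano curve; it enters as the EXPLICIT hypothesis `h45`, the
  printed statement spelled out — D-0026: an XL published estimate whose only use is this glue is
  part of the proof obligation of `hasSLETrace_eight`, not a separately vendored named fact) and
  **Thm. 4.4** as used on p. 981 (`USTPeano.drivingProcess_tendsto`, convergence of the driving
  process to `B(8t)`).

This file records the resulting frontier: `hasSLETrace_eight_of_prop45_of_drivingProcess_tendsto`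
and `forall_hasSLETrace_of_cor35_of_prop45_of_drivingProcess_tendsto` — SLE_κ is generated by
a curve for every `κ`, given exactly Rohde–Schramm's Cor. 3.5 and Lawler–Schramm–Werner's
Prop. 4.5 / Thm. 4.4 — and, now that Cor. 3.5 is itself PROVED on every probability space
(`RohdeSchramm2005_cor35_holds`, hence `hasSLETrace_of_ne_eight_holds`,
`RohdeSchrammCor35Proofs.lean`), **`forall_hasSLETrace_of_prop45_of_drivingProcess_tendsto`**:
`HasSLETrace κ` for every `κ` follows from [LSW04] Prop. 4.5 and Thm. 4.4 alone.

## References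

* S. Rohde, O. Schramm, *Basic properties of SLE*, Ann. of Math. 161 (2005), Cor. 3.5, Thm. 5.1.
* G. F. Lawler, O. Schramm, W. Werner, *Conformal invariance of planar loop-erased random walks
  and uniform spanning trees*, Ann. Probab. 32 (2004), §4.1, §2.1, Thm. 4.4, Prop. 4.5, Thm. 4.7.
-/

noncomputable section

open scoped NNReal
open UpperHalfPlane (upperHalfPlaneSet)

namespace Literature.Probability.RandomPlanarGeometry

/-- **[LSW04] Thm. 4.7 from Prop. 4.5 and Thm. 4.4 alone**: with §4.1 (`nonempty_peanoPath_holds`)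
and §2.1 (`exists_capacityImage_holds`) proved, `hasSLETrace_eight` follows from the two
probabilistic inputs — **Prop. 4.5** (p. 977, in the setting of §4.3: "For every `ε > 0` and
`t̄ > 0` there are some positive `R₀ = R₀(D, t̄, ε)` and `δ = δ(D, t̄, ε)` such that for all
`R > R₀`, `P[sup{|γ̂(t₂) - γ̂(t₁)| : t₁, t₂ ∈ [0, t̄], |t₂ - t₁| ≤ δ} > ε] < ε`", the hypothesis
`h45`, spelled out exactly as in `USTPeano.hasSLETrace_eight_of_LSW`) and Thm. 4.4 as used on
p. 981 (`USTPeano.drivingProcess_tendsto`) — by `USTPeano.hasSLETrace_eight_of_LSW_facts`.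
[cite: LawlerSchrammWerner2004, Thm. 4.7] -/
theorem hasSLETrace_eight_of_prop45_of_drivingProcess_tendsto
    (h45 : ∀ (D : USTPeano.SmoothDomain) (ε t : ℝ), 0 < ε → 0 < t →
      ∃ R₀ δ : ℝ, 0 < δ ∧ ∀ (R : ℝ) (Δ : USTPeano.Domain), R₀ < R → USTPeano.IsApproximation D R Δ →
        ∀ (φ : ConformalEquiv upperHalfPlaneSet Δ.carrier), Δ.IsLSWMap φ →
          ∀ (Γ : USTPeano.PeanoPath Δ → C(ℝ≥0, ℂ)) (W : USTPeano.PeanoPath Δ → C(ℝ≥0, ℝ)),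
            (∀ γ, USTPeano.IsCapacityImage Δ φ γ (Γ γ) (W γ)) →
              USTPeano.ustLaw Δ {γ | ∃ t₁ t₂ : ℝ≥0, (t₁ : ℝ) ≤ t ∧ (t₂ : ℝ) ≤ t ∧
                dist t₁ t₂ ≤ δ ∧ ε < dist (Γ γ t₁) (Γ γ t₂)} < ENNReal.ofReal ε)
    (h44 : USTPeano.drivingProcess_tendsto) : hasSLETrace_eight :=
  USTPeano.hasSLETrace_eight_of_LSW_facts USTPeano.nonempty_peanoPath_holds
    USTPeano.exists_capacityImage_holds h45 h44

/-- **SLE_κ is generated by a curve for every `κ`, from the three remaining printed estimates**: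
Rohde–Schramm's derivative estimate Cor. 3.5 on the canonical space (`RohdeSchramm2005_cor35`,
giving `κ ≠ 8` by `hasSLETrace_of_ne_eight_of_cor35`) and Lawler–Schramm–Werner's Prop. 4.5 and
Thm. 4.4 (giving `κ = 8` by `hasSLETrace_eight_of_prop45_of_drivingProcess_tendsto`), glued by
`hasSLETrace`. Rohde–Schramm (2005), Thm. 5.1; [LSW04] Thm. 4.7. [cite: RohdeSchramm2005, Thm 5.1] -/
theorem forall_hasSLETrace_of_cor35_of_prop45_of_drivingProcess_tendsto
    (h35 : RohdeSchramm2005_cor35 Process.preWienerMeasure)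
    (h45 : ∀ (D : USTPeano.SmoothDomain) (ε t : ℝ), 0 < ε → 0 < t →
      ∃ R₀ δ : ℝ, 0 < δ ∧ ∀ (R : ℝ) (Δ : USTPeano.Domain), R₀ < R → USTPeano.IsApproximation D R Δ →
        ∀ (φ : ConformalEquiv upperHalfPlaneSet Δ.carrier), Δ.IsLSWMap φ →
          ∀ (Γ : USTPeano.PeanoPath Δ → C(ℝ≥0, ℂ)) (W : USTPeano.PeanoPath Δ → C(ℝ≥0, ℝ)),
            (∀ γ, USTPeano.IsCapacityImage Δ φ γ (Γ γ) (W γ)) →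
              USTPeano.ustLaw Δ {γ | ∃ t₁ t₂ : ℝ≥0, (t₁ : ℝ) ≤ t ∧ (t₂ : ℝ) ≤ t ∧
                dist t₁ t₂ ≤ δ ∧ ε < dist (Γ γ t₁) (Γ γ t₂)} < ENNReal.ofReal ε)
    (h44 : USTPeano.drivingProcess_tendsto) (κ : ℝ≥0) : HasSLETrace κ :=
  hasSLETrace (hasSLETrace_eight_of_prop45_of_drivingProcess_tendsto h45 h44)
    (hasSLETrace_of_ne_eight_of_cor35 h35) κ

/-- **SLE_κ is generated by a curve for every `κ`, from [LSW04] Prop. 4.5 and Thm. 4.4 alone.**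
Rohde–Schramm's theorem (`κ ≠ 8`) is proved in the tree (`hasSLETrace_of_ne_eight_holds`, from
`RohdeSchramm2005_cor35_holds`); the `κ = 8` case is
`hasSLETrace_eight_of_prop45_of_drivingProcess_tendsto` (Prop. 4.5 as the explicit hypothesis
`h45`, Thm. 4.4 as `USTPeano.drivingProcess_tendsto`). This is the exact remaining content of
"`HasSLETrace κ` for all `κ`": the uniform continuity estimate Prop. 4.5 and the driving-process
convergence Thm. 4.4 of the UST Peano curve scaling limit. Rohde–Schramm (2005), Thm. 5.1;
[LSW04] Thm. 4.7. [cite: LawlerSchrammWerner2004, Thm. 4.7] -/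
theorem forall_hasSLETrace_of_prop45_of_drivingProcess_tendsto
    (h45 : ∀ (D : USTPeano.SmoothDomain) (ε t : ℝ), 0 < ε → 0 < t →
      ∃ R₀ δ : ℝ, 0 < δ ∧ ∀ (R : ℝ) (Δ : USTPeano.Domain), R₀ < R → USTPeano.IsApproximation D R Δ →
        ∀ (φ : ConformalEquiv upperHalfPlaneSet Δ.carrier), Δ.IsLSWMap φ →
          ∀ (Γ : USTPeano.PeanoPath Δ → C(ℝ≥0, ℂ)) (W : USTPeano.PeanoPath Δ → C(ℝ≥0, ℝ)),
            (∀ γ, USTPeano.IsCapacityImage Δ φ γ (Γ γ) (W γ)) →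
              USTPeano.ustLaw Δ {γ | ∃ t₁ t₂ : ℝ≥0, (t₁ : ℝ) ≤ t ∧ (t₂ : ℝ) ≤ t ∧
                dist t₁ t₂ ≤ δ ∧ ε < dist (Γ γ t₁) (Γ γ t₂)} < ENNReal.ofReal ε)
    (h44 : USTPeano.drivingProcess_tendsto) (κ : ℝ≥0) : HasSLETrace κ :=
  hasSLETrace (hasSLETrace_eight_of_prop45_of_drivingProcess_tendsto h45 h44)
    hasSLETrace_of_ne_eight_holds κ

end Literature.Probability.RandomPlanarGeometry
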